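import Summits.QuantumFields.YangMills.Theorems.BalabanLadderIRTwistedSlabFibredSliceChart
import Summits.QuantumFields.YangMills.Theorems.BalabanLadderIRTwistedSlabExponent
import HarnessLib

/-!
# The slice chart in B89's currency, IV: the orbit map IS a gauge transformation of the slice configuration, `orbitCfg (φ, y) = e^{φ} • (e^{y}·L)`;
# with a PRODUCT frame the fibred chart map has lit-4's tube form `Θ'(z, y) = act (e z) (σ y)` and the twisted exponent is `p`-INDEPENDENT:
# `twistedExponent k (Ψ(p, y)) = chartAction L (slabTwistPhase k) (T_V y)` (gauge invariance, K9) — the phase input of L18 ∕ L9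

HELPER toward stub **T1** `TwistedSlabAnchor` (LINE `twisted-slab-continuity`, crux `IRcof` stmt-QuantumFields-26930, census row 43;
LEAD prover ym-ir-line-tsc-p1 g3; `--supports` the crux, `--as helper`).  Sequel of `…TwistedSlabFibredSliceChart` (K17) and `…TwistedSlabExponent` (K9).
* §1 `expGauge φ : sites → SU(N)` (`x ↦ e^{φ(x)}`, K10 `exp_mem_specialUnitaryGroup_of_conjTranspose`), `sliceCfg hL y` (the TRANSVERSAL `σ y = e^{y}·L ∈ SU(N)^E`),
  `coe_expGauge_apply`, `coe_sliceCfg_apply`, `sliceCfg_zero`, ★ `orbitCfg_eq_gaugeAct` (`orbitCfg (φ, y) = gaugeAct (expGauge φ) (sliceCfg y)`),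
  ★ `twistedExponent_orbitCfg` (`= twistedExponent k (sliceCfg y)`, K9 `twistedExponent_gaugeAct`), `twistedExponent_sliceCfg` (`= chartAction L (slabTwistPhase k) y`, K9).
* §2 `prodFrame T_M T_V : WithLp 2 (M × V) ≃L[ℝ] suFields × realCoulombSlice L` (product of two frames through Mathlib's `WithLp.prodContinuousLinearEquiv`),
  `prodFrame_toLp`, ★ `fibredChartMap_prodFrame` (`Ψ(p, y) = gaugeAct (expGauge (T_M p)) (sliceCfg (T_V y))` — lit-4 L17∕L18's `Θ'(z, y) = act (e z) (σ y)`),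
  ★★ `twistedExponent_fibredChartMap_prodFrame` (the phase is `p`-independent: `= chartAction L (slabTwistPhase k) (T_V y)`).
NOT here (honest scope): the slice property ∕ stabiliser data (L17 §4), the one-point Taylor ∕ coercivity ∕ separation data on `V` (K5∕K13∕K7 through `T_V`,
to be produced Frobenius-side), the L18∕L21 call = T1-tree-exact; anything uniform in `β` (M3); the cluster expansion (M4); T1-box 0∕1, T1 proper 0∕1.

HONEST FRAMING: algebra ∕ bookkeeping on one box; nothing here bears on `IRcof`, `IR`, or the Yang–Mills mass gap (Clay: NOT proved); R4 = `BalabanLadder.UV`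
only.  References: M. García Pérez, A. González-Arroyo, M. Okawa, JHEP 10 (2017) 150 §2.2–§2.5; I. Montvay, G. Münster, *Quantum Fields on a Lattice* §3.2.5;
E. Hasenpflug, D. Rudolf, B. Sprungk (2024) §3.1 Assumption 3 (T).
-/

set_option autoImplicit false

noncomputable section

open scoped Matrix Matrix.Norms.L2Operator Topology
open MeasureTheory Filter NormedSpace Set WithLp
open Literature.MathematicalPhysics.QuantumFieldTheory Literature.MathematicalPhysics.QuantumLattice
open Literature.Analysis.OperatorTheory

namespace Summit.QuantumFields.YangMills.Cruxes.IRcof.TwistedSlab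

variable {N : ℕ} {n₀ n₁ n₂ n₃ : ℕ}

/-! ## §1 The orbit map is a gauge transformation of the slice configuration -/

section Gauge

variable {L : FinTorusSite n₀ n₁ n₂ n₃ × Fin 4 → Matrix (Fin N) (Fin N) ℂ}

/-- **The gauge transformation generated by `𝔰𝔲` gauge data**: `expGauge φ = (x ↦ e^{φ(x)}) : sites → SU(N)`. [cite: MontvayMunster1994, §3.2.5 p. 122] -/
def expGauge (φ : suFields N n₀ n₁ n₂ n₃) : FinTorusSite n₀ n₁ n₂ n₃ → Matrix.specialUnitaryGroup (Fin N) ℂ :=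
  fun x => ⟨exp ((φ : FinTorusSite n₀ n₁ n₂ n₃ → Matrix (Fin N) (Fin N) ℂ) x), exp_mem_specialUnitaryGroup_of_conjTranspose (φ.2 x).1 (φ.2 x).2⟩

/-- Values of `expGauge`. [folklore] -/
@[simp] theorem coe_expGauge_apply (φ : suFields N n₀ n₁ n₂ n₃) (x : FinTorusSite n₀ n₁ n₂ n₃) :
    ((expGauge φ x : Matrix.specialUnitaryGroup (Fin N) ℂ) : Matrix (Fin N) (Fin N) ℂ) = exp ((φ : FinTorusSite n₀ n₁ n₂ n₃ → Matrix (Fin N) (Fin N) ℂ) x) :=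
  rfl

/-- **The transversal (slice configuration)** `sliceCfg hL y = (e ↦ e^{y_{e.2}(e.1)} · L(e)) ∈ SU(N)^E` for real Coulomb-slice data `y` and `L ∈ SU(N)^E`.
[cite: GarciaperezGonzalezarroyoOkawa2017, §2.3, §2.5] -/
def sliceCfg (hL : ∀ e, L e ∈ Matrix.specialUnitaryGroup (Fin N) ℂ) (y : realCoulombSlice L) :
    FinTorusSite n₀ n₁ n₂ n₃ × Fin 4 → Matrix.specialUnitaryGroup (Fin N) ℂ :=
  fun e => ⟨exp ((y : Fin 4 → FinTorusSite n₀ n₁ n₂ n₃ → Matrix (Fin N) (Fin N) ℂ) e.2 e.1) * L e,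
    Submonoid.mul_mem _ (exp_mem_specialUnitaryGroup_of_conjTranspose ((y.2.1 e.2 e.1).1) ((y.2.1 e.2 e.1).2)) (hL e)⟩

/-- Links of the slice configuration. [folklore] -/
@[simp] theorem coe_sliceCfg_apply (hL : ∀ e, L e ∈ Matrix.specialUnitaryGroup (Fin N) ℂ) (y : realCoulombSlice L) (e : FinTorusSite n₀ n₁ n₂ n₃ × Fin 4) :
    ((sliceCfg hL y e : Matrix.specialUnitaryGroup (Fin N) ℂ) : Matrix (Fin N) (Fin N) ℂ) =
      exp ((y : Fin 4 → FinTorusSite n₀ n₁ n₂ n₃ → Matrix (Fin N) (Fin N) ℂ) e.2 e.1) * L e := rfl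

/-- `σ 0 = L`. [folklore] -/
theorem sliceCfg_zero (hL : ∀ e, L e ∈ Matrix.specialUnitaryGroup (Fin N) ℂ) : sliceCfg hL 0 = fun e => ⟨L e, hL e⟩ := by
  funext e; apply Subtype.ext
  rw [coe_sliceCfg_apply, ZeroMemClass.coe_zero, Pi.zero_apply, Pi.zero_apply, exp_zero, Matrix.one_mul]

/-- ★ **The orbit map is the gauge transformation `e^{φ}` of the slice configuration `e^{y}·L`**: `orbitCfg (φ, y) = gaugeAct (expGauge φ) (sliceCfg y)`
(the inverse of `e^{φ(x+e_μ)} ∈ SU(N)` is `e^{−φ(x+e_μ)}`). [cite: GarciaperezGonzalezarroyoOkawa2017, §2.3, §2.5] [cite: MontvayMunster1994, §3.2.5 p. 122] -/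
theorem orbitCfg_eq_gaugeAct (hL : ∀ e, L e ∈ Matrix.specialUnitaryGroup (Fin N) ℂ) (q : suFields N n₀ n₁ n₂ n₃ × realCoulombSlice L) :
    orbitCfg hL q = gaugeAct (expGauge q.1) (sliceCfg hL q.2) := by
  funext e; apply Subtype.ext
  rw [coe_orbitCfg_apply, coe_gaugeAct_apply, coe_expGauge_apply, coe_expGauge_apply, coe_sliceCfg_apply, ← Matrix.exp_conjTranspose, (q.1.2 _).1,
    suDataIncl_apply, orbitFluct, Matrix.mul_assoc (exp _) (exp _) (L _)]

/-- ★ **Gauge invariance of the phase along the orbit map**: `twistedExponent k (orbitCfg (φ, y)) = twistedExponent k (sliceCfg y)` (K9 `twistedExponent_gaugeAct`).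
[cite: GarciaperezGonzalezarroyoOkawa2017, §2.2] -/
theorem twistedExponent_orbitCfg (hL : ∀ e, L e ∈ Matrix.specialUnitaryGroup (Fin N) ℂ) (k : ZMod N) (q : suFields N n₀ n₁ n₂ n₃ × realCoulombSlice L) :
    twistedExponent k (orbitCfg hL q) = twistedExponent k (sliceCfg hL q.2) := by
  rw [orbitCfg_eq_gaugeAct, twistedExponent_gaugeAct]

/-- **The phase on the transversal is the exponential-chart action** `chartAction L (slabTwistPhase k) y` (K9 `twistedExponent_eq_chartAction_of_coe`).
[cite: GarciaperezGonzalezarroyoOkawa2017, §2.5] -/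
theorem twistedExponent_sliceCfg (hL : ∀ e, L e ∈ Matrix.specialUnitaryGroup (Fin N) ℂ) (k : ZMod N) (y : realCoulombSlice L) :
    twistedExponent k (sliceCfg hL y) = chartAction L (slabTwistPhase k) (y : Fin 4 → FinTorusSite n₀ n₁ n₂ n₃ → Matrix (Fin N) (Fin N) ℂ) :=
  twistedExponent_eq_chartAction_of_coe k (fun e => ⟨L e, hL e⟩) (y : Fin 4 → FinTorusSite n₀ n₁ n₂ n₃ → Matrix (Fin N) (Fin N) ℂ) (sliceCfg hL y)
    fun _ _ => rfl

end Gauge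

/-! ## §2 Product frames: the fibred chart map in tube form and the `p`-independent phase -/

section ProdFrame

variable {L : FinTorusSite n₀ n₁ n₂ n₃ × Fin 4 → Matrix (Fin N) (Fin N) ℂ}
variable {M : Type*} [NormedAddCommGroup M] [InnerProductSpace ℝ M]
variable {V : Type*} [NormedAddCommGroup V] [InnerProductSpace ℝ V]

/-- **Product frame**: two frames `T_M : M ≃L suFields`, `T_V : V ≃L realCoulombSlice L` assembled on the `L²`-product model `WithLp 2 (M × V)`.
[cite: Breitung1994, §2.3 Definitions 4–5 pp. 14–15] -/
def prodFrame (T_M : M ≃L[ℝ] suFields N n₀ n₁ n₂ n₃) (T_V : V ≃L[ℝ] realCoulombSlice L) :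
    WithLp 2 (M × V) ≃L[ℝ] (suFields N n₀ n₁ n₂ n₃ × realCoulombSlice L) :=
  (WithLp.prodContinuousLinearEquiv 2 ℝ M V).trans (T_M.prodCongr T_V)

/-- The product frame on `toLp (p, y)` is `(T_M p, T_V y)`. [folklore] -/
@[simp] theorem prodFrame_toLp (T_M : M ≃L[ℝ] suFields N n₀ n₁ n₂ n₃) (T_V : V ≃L[ℝ] realCoulombSlice L) (p : M) (y : V) :
    prodFrame T_M T_V (toLp 2 (p, y)) = (T_M p, T_V y) := rfl

/-- ★ **THE FIBRED CHART MAP IN TUBE FORM** (lit-4 L17∕L18 `Θ'(z, y) = act (e z) (σ y)`): with a product frame,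
`fibredChartMap hL (prodFrame T_M T_V) (p, y) = gaugeAct (expGauge (T_M p)) (sliceCfg hL (T_V y))`. [cite: HasenpflugRudolfSprungk2024, §3.1 Assumption 3 (T)] -/
theorem fibredChartMap_prodFrame (hL : ∀ e, L e ∈ Matrix.specialUnitaryGroup (Fin N) ℂ) (T_M : M ≃L[ℝ] suFields N n₀ n₁ n₂ n₃)
    (T_V : V ≃L[ℝ] realCoulombSlice L) (p : M) (y : V) :
    fibredChartMap hL (prodFrame T_M T_V) (p, y) = gaugeAct (expGauge (T_M p)) (sliceCfg hL (T_V y)) := by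
  rw [fibredChartMap, prodFrame_toLp, orbitCfg_eq_gaugeAct]

/-- ★★ **THE PHASE IS `p`-INDEPENDENT IN THE FIBRED CHART** (gauge invariance): with a product frame,
`twistedExponent k (Ψ(p, y)) = chartAction L (slabTwistPhase k) (T_V y)` — the hypothesis shape of lit-4's L9∕L18 (phase constant along the critical
manifold directions, one-point data in `y` only). [cite: GarciaperezGonzalezarroyoOkawa2017, §2.2, §2.5] [cite: HasenpflugRudolfSprungk2024, §3.1 Assumption 3 (M)(T)] -/
theorem twistedExponent_fibredChartMap_prodFrame (hL : ∀ e, L e ∈ Matrix.specialUnitaryGroup (Fin N) ℂ) (k : ZMod N)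
    (T_M : M ≃L[ℝ] suFields N n₀ n₁ n₂ n₃) (T_V : V ≃L[ℝ] realCoulombSlice L) (p : M) (y : V) :
    twistedExponent k (fibredChartMap hL (prodFrame T_M T_V) (p, y)) =
      chartAction L (slabTwistPhase k) ((T_V y : realCoulombSlice L) : Fin 4 → FinTorusSite n₀ n₁ n₂ n₃ → Matrix (Fin N) (Fin N) ℂ) := by
  rw [fibredChartMap_prodFrame, ← orbitCfg_eq_gaugeAct hL (T_M p, T_V y), twistedExponent_orbitCfg, twistedExponent_sliceCfg]

/-- The phase at the origin of the fibred chart is the phase of the background. [folklore] -/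
theorem twistedExponent_fibredChartMap_prodFrame_zero (hL : ∀ e, L e ∈ Matrix.specialUnitaryGroup (Fin N) ℂ) (k : ZMod N)
    (T_M : M ≃L[ℝ] suFields N n₀ n₁ n₂ n₃) (T_V : V ≃L[ℝ] realCoulombSlice L) (p : M) :
    twistedExponent k (fibredChartMap hL (prodFrame T_M T_V) (p, 0)) = twistedExponent k (fun e => (⟨L e, hL e⟩ : Matrix.specialUnitaryGroup (Fin N) ℂ)) := by
  rw [fibredChartMap_prodFrame, ← orbitCfg_eq_gaugeAct hL (T_M p, T_V 0), twistedExponent_orbitCfg, map_zero, sliceCfg_zero]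

end ProdFrame

end Summit.QuantumFields.YangMills.Cruxes.IRcof.TwistedSlab

end
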